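import Mathlib
import Literature.Analysis.OperatorTheory.ContractiveDetComplexity
import Summits.ValiantsHypothesis.ValiantsHypothesis.Theorems.ContractivityPricePriceOfContractivityStubArcStep
import Summits.ValiantsHypothesis.ValiantsHypothesis.Theorems.ContractivityPricePriceOfContractivityStubPermCounts
import Summits.ValiantsHypothesis.ValiantsHypothesis.Theorems.ContractivityPricePriceOfContractivityStubArcInduction
import Summits.ValiantsHypothesis.ValiantsHypothesis.Theorems.ContractivityPricePriceOfContractivityStubCycleBalancing
import Summits.ValiantsHypothesis.ValiantsHypothesis.Theorems.ContractivityPricePriceOfContractivityStubCycleBound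
import Summits.ValiantsHypothesis.ValiantsHypothesis.Theorems.ContractivityPricePriceOfContractivityStubSameSizeMonochromeBlocks
import HarnessLib

/-!
# Crux `PriceOfContractivity` (stmt-ValiantsHypothesis-10583), line `birth` — stub
# `stub_balancedBudget_injective`: the multiaffine balanced budget (same size, polynomial norm)

Route `ValiantsHypothesis/ContractivityPrice`, crux K1
(`Summit.ValiantsHypothesis.ValiantsHypothesis.Theses.ContractivityPrice.PriceOfContractivity`).
This file proves the registered partial case `stub_balancedBudget_injective` of the lead's
skeleton (line `birth`, rev 5): for an INJECTIVE colouring `κ` (a multiaffine Sylvester pencil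
`det (1 + diagonal (X ∘ κ) * K₀)`, at most one row per variable) with no zero on the closed
polydisc of radius `2`, the same polynomial is `det (1 + diagonal (X ∘ κ) * K₁)` — same size, same
colouring — with `‖K₁‖_op ≤ 120 R⁵`.

Proof.
1. *Principal minors* (`norm_det_submatrix_le`).  For an injective `w : Fin (k+1) → Fin R`,
   evaluate the pencil at the point `z` equal to `t` on the colours of `range w` and `0`
   elsewhere: the value is `det (1 + diagonal c * K₀)` with `c = t` on `range w` and `c = 0` off
   it (injectivity of `κ`), which equals `det (1 + t • K₀[w])` by the Weinstein–Aronszajn identity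
   `det (1 + P (Q K₀)) = det (1 + Q K₀ P)` for the rank factorisation `diagonal c = P * Q` through
   `Fin (k+1)` (`det_one_add_diagonal_mul_eq_det_submatrix`).  Hence
   `t ↦ det (1 + t • K₀[w]) = ∏ᵢ (1 + t λᵢ)` (eigenvalues `λᵢ` of `K₀[w]`) has no zero with
   `‖t‖ ≤ 2`, every `‖λᵢ‖ ≤ 1/2`, and `‖det K₀[w]‖ = ∏ᵢ ‖λᵢ‖ ≤ (1/2)^(k+1)`.
2. *Cycle-mean bound* (Theorem 4 = the landed stubs `stub_cycleBound`, `stub_cycleBalancing`,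
   `stub_arcInduction`, `stub_arcStep`, `stub_permCounts`) with `ν = 1/2`: every cycle product of
   `K₀` has modulus `≤ (120 R³)^{length}`.
3. *Balancing* (`stub_cycleBalancing` at level `M = 120 R³`; vacuous for `R = 0`): a positive
   diagonal `d` with `d i ‖K₀ i j‖ / d j ≤ M`.
4. `K₁ := D K₀ D⁻¹`, `D = diagonal d`: all entries have modulus `≤ M`, so
   `‖K₁‖_op ≤ R² M = 120 R⁵` (`norm_toEuclideanCLM_le_of_entry_le`), and the pencil determinant
   is unchanged because `D` commutes with `diagonal (X ∘ κ)` (`det_pencil_diagConj`).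
-/

noncomputable section

-- single-conjunct layout: Sub = Summit, duplicated namespace component intended
set_option linter.dupNamespace false

namespace Summit.ValiantsHypothesis.ValiantsHypothesis.Theorems.PriceOfContractivity.BalancedBudgetInjective

open Matrix
open Summit.ValiantsHypothesis.ValiantsHypothesis.Theorems.PriceOfContractivity.MonochromeBlocks
  (card_roots_charpoly det_one_add_smul_eq_prod_roots exists_enum_of_card_eq
    norm_le_half_of_prod_ne_zero)

/-! ### Principal minors of a zero-free multiaffine pencil -/

/-- **Restriction of the scalar pencil to the support of its weights.** If the weight vector `c`
equals `t` on the range of an injective `w : m → n` and vanishes off it, then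
`det (1 + diagonal c * K) = det (1 + t • K[w])`: `diagonal c = P * Q` with `P : n × m` selecting
the columns `w a` and `Q = t • Pᵀ`, and `det (1 + P (Q K)) = det (1 + Q K P)`
(Weinstein–Aronszajn, `Matrix.det_one_add_mul_comm`) with `Q K P = t • K[w]`. [folklore] -/
theorem det_one_add_diagonal_mul_eq_det_submatrix {m n : Type*} [Fintype m] [DecidableEq m]
    [Fintype n] [DecidableEq n] (K : Matrix n n ℂ) (w : m → n) (hw : Function.Injective w)
    (c : n → ℂ) (t : ℂ) (hon : ∀ a, c (w a) = t) (hoff : ∀ i, (∀ a, i ≠ w a) → c i = 0) :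
    (1 + diagonal c * K).det = (1 + t • K.submatrix w w).det := by
  have hPQ : ((Matrix.of fun i a => if i = w a then (1 : ℂ) else 0) : Matrix n m ℂ) *
      ((Matrix.of fun a j => if j = w a then t else 0) : Matrix m n ℂ) = diagonal c := by
    ext i j
    simp only [mul_apply, of_apply, diagonal_apply]
    by_cases hi : ∃ a, i = w a
    · obtain ⟨a₀, rfl⟩ := hi
      rw [Finset.sum_eq_single a₀ (fun a _ ha => by simp [hw.eq_iff, Ne.symm ha]) (by simp),
        if_pos rfl, one_mul, hon a₀]
      obtain rfl | hj := eq_or_ne j (w a₀)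
      · rfl
      · rw [if_neg hj, if_neg (Ne.symm hj)]
    · push Not at hi
      have h0 : ∀ a, (if i = w a then (1 : ℂ) else 0) * (if j = w a then t else 0) = 0 :=
        fun a => by rw [if_neg (hi a), zero_mul]
      rw [Finset.sum_eq_zero (fun a _ => h0 a), hoff i hi, ite_self]
  have hQKP : ((Matrix.of fun a j => if j = w a then t else 0) : Matrix m n ℂ) * K *
      ((Matrix.of fun i a => if i = w a then (1 : ℂ) else 0) : Matrix n m ℂ) =
        t • K.submatrix w w := by
    ext a b
    simp [mul_apply, ite_mul, mul_ite, Finset.sum_ite_eq']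
  rw [← hPQ, Matrix.mul_assoc, det_one_add_mul_comm, hQKP]

/-- **Principal minors of a zero-free multiaffine pencil.** If `κ` is injective and
`det (1 + diagonal (X ∘ κ) * K₀)` has no zero on the closed polydisc of radius `2`, then for every
injective `w : Fin (k+1) → Fin R` the principal minor satisfies `‖det K₀[w]‖ ≤ (1/2)^(k+1)`: the
one-variable restriction `det (1 + t • K₀[w]) = ∏ᵢ (1 + t λᵢ)` is zero-free on `‖t‖ ≤ 2`, so every
eigenvalue has `‖λᵢ‖ ≤ 1/2`, and `det K₀[w] = ∏ᵢ λᵢ`. [folklore] -/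
theorem norm_det_submatrix_le {R : ℕ} {σ : Type} (K₀ : Matrix (Fin R) (Fin R) ℂ) (κ : Fin R → σ)
    (hκ : Function.Injective κ)
    (hz : ∀ z : σ → ℂ, (∀ j, ‖z j‖ ≤ 2) → MvPolynomial.eval z (1 + Matrix.diagonal (fun i =>
      MvPolynomial.X (κ i)) * K₀.map (fun a : ℂ => (MvPolynomial.C a : MvPolynomial σ ℂ))).det ≠ 0)
    (k : ℕ) (w : Fin (k + 1) → Fin R) (hw : Function.Injective w) :
    ‖(K₀.submatrix w w).det‖ ≤ (1 / 2 : ℝ) ^ (k + 1) := by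
  classical
  set M : Matrix (Fin (k + 1)) (Fin (k + 1)) ℂ := K₀.submatrix w w with hM
  -- the test points: `t` on the colours of `range w`, `0` elsewhere
  have hpt : ∀ t : ℂ, ‖t‖ ≤ 2 → ∃ z : σ → ℂ, (∀ j, ‖z j‖ ≤ 2) ∧ (∀ a, z (κ (w a)) = t) ∧
      ∀ i, (∀ a, i ≠ w a) → z (κ i) = 0 := by
    intro t ht
    refine ⟨fun e => if ∃ a, κ (w a) = e then t else 0, fun j => ?_, fun a => if_pos ⟨a, rfl⟩,
      fun i hi => if_neg ?_⟩
    · dsimp only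
      split_ifs
      · exact ht
      · simp
    · rintro ⟨a, ha⟩
      exact hi a (hκ ha).symm
  -- the one-variable restriction is zero-free on `‖t‖ ≤ 2`
  have hMt : ∀ t : ℂ, ‖t‖ ≤ 2 → (1 + t • M).det ≠ 0 := by
    intro t ht
    obtain ⟨z, hz2, hon, hoff⟩ := hpt t ht
    have h := hz z hz2
    rwa [Literature.Analysis.OperatorTheory.eval_det_one_add_diagonal_mul_map_C,
      det_one_add_diagonal_mul_eq_det_submatrix K₀ w hw (fun i => z (κ i)) t hon hoff] at h
  -- eigenvalues of `M`, enumerated by `Fin (k+1)`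
  obtain ⟨d, hd⟩ :=
    exists_enum_of_card_eq (m := Fin (k + 1)) M.charpoly.roots (card_roots_charpoly M)
  have hdetM : ∀ t : ℂ, (1 + t • M).det = ∏ i, (1 + t * d i) := fun t =>
    (det_one_add_smul_eq_prod_roots M t).trans (hd fun l => 1 + t * l).symm
  have hprod : ∀ t : ℂ, ‖t‖ ≤ 2 → ∏ i, (1 + t * d i) ≠ 0 := fun t ht => by
    rw [← hdetM t]
    exact hMt t ht
  have hdn : ∀ i, ‖d i‖ ≤ 1 / 2 := norm_le_half_of_prod_ne_zero d hprod
  have hdet : M.det = ∏ i, d i := by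
    rw [Matrix.det_eq_prod_roots_charpoly, hd fun l => l, Multiset.map_id']
  rw [hdet, norm_prod]
  calc ∏ i, ‖d i‖ ≤ ∏ _i : Fin (k + 1), (1 / 2 : ℝ) :=
        Finset.prod_le_prod (fun i _ => norm_nonneg _) fun i _ => hdn i
    _ = (1 / 2 : ℝ) ^ (k + 1) := by
        rw [Finset.prod_const, Finset.card_univ, Fintype.card_fin]

/-! ### Glue: entrywise bound ⟹ operator norm; pencil invariance under diagonal similarity -/

/-- Entrywise bound ⟹ operator-norm bound: if every entry of `K ∈ ℂ^{R×R}` has modulus `≤ M`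
(`M ≥ 0`) then `‖K‖_op ≤ R² · M` (crude: `|(Kx)_i| ≤ M · R · ‖x‖` and `‖y‖₂ ≤ Σ |y_i|`).
[folklore] -/
theorem norm_toEuclideanCLM_le_of_entry_le {R : ℕ} (K : Matrix (Fin R) (Fin R) ℂ) {M : ℝ}
    (hM : 0 ≤ M) (h : ∀ i j, ‖K i j‖ ≤ M) :
    ‖Matrix.toEuclideanCLM (𝕜 := ℂ) K‖ ≤ (R : ℝ) ^ 2 * M := by
  refine ContinuousLinearMap.opNorm_le_bound _ (by positivity) fun x => ?_
  have hx : ∀ j, ‖x j‖ ≤ ‖x‖ := fun j => PiLp.norm_apply_le x j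
  -- each coordinate of `K x`
  have hcoord : ∀ i, ‖(Matrix.toEuclideanCLM (𝕜 := ℂ) K x) i‖ ≤ M * ((R : ℝ) * ‖x‖) := by
    intro i
    have hKi : (Matrix.toEuclideanCLM (𝕜 := ℂ) K x) i = ∑ j, K i j * x j := by
      rw [Matrix.ofLp_toEuclideanCLM]
      rfl
    rw [hKi]
    calc ‖∑ j, K i j * x j‖ ≤ ∑ j, ‖K i j * x j‖ := norm_sum_le _ _
      _ ≤ ∑ _j : Fin R, M * ‖x‖ := Finset.sum_le_sum fun j _ => by
          rw [norm_mul]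
          exact mul_le_mul (h i j) (hx j) (norm_nonneg _) hM
      _ = M * ((R : ℝ) * ‖x‖) := by
          rw [Finset.sum_const, Finset.card_univ, Fintype.card_fin, nsmul_eq_mul]; ring
  -- `‖K x‖ ≤ Σ_i ‖(K x)_i‖ ≤ R · (M R ‖x‖)`
  have hsum : ‖Matrix.toEuclideanCLM (𝕜 := ℂ) K x‖ ≤
      ∑ i, ‖(Matrix.toEuclideanCLM (𝕜 := ℂ) K x) i‖ := by
    rw [EuclideanSpace.norm_eq]
    refine Real.sqrt_le_iff.mpr ⟨Finset.sum_nonneg fun i _ => norm_nonneg _, ?_⟩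
    exact Finset.sum_sq_le_sq_sum_of_nonneg fun i _ => norm_nonneg _
  calc ‖Matrix.toEuclideanCLM (𝕜 := ℂ) K x‖
      ≤ ∑ i, ‖(Matrix.toEuclideanCLM (𝕜 := ℂ) K x) i‖ := hsum
    _ ≤ ∑ _i : Fin R, M * ((R : ℝ) * ‖x‖) := Finset.sum_le_sum fun i _ => hcoord i
    _ = (R : ℝ) ^ 2 * M * ‖x‖ := by
        rw [Finset.sum_const, Finset.card_univ, Fintype.card_fin, nsmul_eq_mul]; ring

/-- **Pencil invariance under diagonal similarity.** For `d i ≠ 0`,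
`det(1 + D_κ · (D K D⁻¹)) = det(1 + D_κ · K)` with `D = diag(d)`: `D` commutes with `D_κ`, so the
two pencils are intertwined by `D.map C` (proved without inverses: `P₂ · D = D · P₁`). [folklore] -/
theorem det_pencil_diagConj {R : ℕ} {σ : Type} (K : Matrix (Fin R) (Fin R) ℂ) (κ : Fin R → σ)
    (d : Fin R → ℂ) (hd : ∀ i, d i ≠ 0) :
    (1 + Matrix.diagonal (fun i => MvPolynomial.X (κ i)) *
        (Matrix.of fun i j => d i * K i j * (d j)⁻¹).map
          (fun a : ℂ => (MvPolynomial.C a : MvPolynomial σ ℂ))).det =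
      (1 + Matrix.diagonal (fun i => MvPolynomial.X (κ i)) *
        K.map (fun a : ℂ => (MvPolynomial.C a : MvPolynomial σ ℂ))).det := by
  set D : Matrix (Fin R) (Fin R) (MvPolynomial σ ℂ) := Matrix.diagonal fun i => MvPolynomial.C (d i)
    with hD
  set P₁ : Matrix (Fin R) (Fin R) (MvPolynomial σ ℂ) :=
    1 + Matrix.diagonal (fun i => MvPolynomial.X (κ i)) *
      K.map (fun a : ℂ => (MvPolynomial.C a : MvPolynomial σ ℂ)) with hP₁
  set P₂ : Matrix (Fin R) (Fin R) (MvPolynomial σ ℂ) :=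
    1 + Matrix.diagonal (fun i => MvPolynomial.X (κ i)) *
      (Matrix.of fun i j => d i * K i j * (d j)⁻¹).map
        (fun a : ℂ => (MvPolynomial.C a : MvPolynomial σ ℂ)) with hP₂
  -- the intertwining identity
  have hint : P₂ * D = D * P₁ := by
    refine Matrix.ext fun i j => ?_
    have hj' : (MvPolynomial.C (d j)⁻¹ : MvPolynomial σ ℂ) * MvPolynomial.C (d j) = 1 := by
      rw [← map_mul, inv_mul_cancel₀ (hd j), map_one]
    simp only [hP₁, hP₂, hD, Matrix.mul_diagonal, Matrix.diagonal_mul, Matrix.add_apply,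
      Matrix.one_apply, Matrix.map_apply, Matrix.of_apply, map_mul]
    by_cases hij : i = j
    · subst hij
      simp only [if_true]
      linear_combination (MvPolynomial.X (κ i) * MvPolynomial.C (d i) * MvPolynomial.C (K i i)) * hj'
    · simp only [if_neg hij]
      linear_combination (MvPolynomial.X (κ i) * MvPolynomial.C (d i) * MvPolynomial.C (K i j)) * hj'
  have hdetD : D.det ≠ 0 := by
    rw [hD, Matrix.det_diagonal]
    exact Finset.prod_ne_zero_iff.mpr fun i _ => by
      rw [Ne, MvPolynomial.C_eq_zero]; exact hd i
  have := congrArg Matrix.det hint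
  rw [Matrix.det_mul, Matrix.det_mul, mul_comm D.det] at this
  exact mul_right_cancel₀ hdetD this

/-! ### The stub -/

/-- **Stub `stub_balancedBudget_injective` (multiaffine balanced budget, same size, polynomial
norm).** If `κ : Fin R → σ` is injective and the Sylvester pencil `det (1 + diagonal (X ∘ κ) * K₀)`
has no zero on the closed polydisc of radius `2`, then the same polynomial is
`det (1 + diagonal (X ∘ κ) * K₁)` for a matrix `K₁` (a positive diagonal conjugate of `K₀`) of
operator norm `≤ 120 R⁵`: principal minors `≤ (1/2)^{size}`, the cycle-mean bound with `ν = 1/2`,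
max-plus balancing at level `120 R³`, and `‖·‖_op ≤ R² · max |entry|`. [folklore] -/
theorem stub_balancedBudget_injective :
    ∀ (R : ℕ) {σ : Type} (K₀ : Matrix (Fin R) (Fin R) ℂ) (κ : Fin R → σ),
      Function.Injective κ →
      (∀ z : σ → ℂ, (∀ j, ‖z j‖ ≤ 2) → MvPolynomial.eval z (1 + Matrix.diagonal (fun i => MvPolynomial.X (κ i)) * K₀.map (fun a : ℂ => (MvPolynomial.C a : MvPolynomial σ ℂ))).det ≠ 0) →
      ∃ (K₁ : Matrix (Fin R) (Fin R) ℂ),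
        ‖Matrix.toEuclideanCLM (𝕜 := ℂ) K₁‖ ≤ 120 * (R : ℝ) ^ 5 ∧
        (1 + Matrix.diagonal (fun i => MvPolynomial.X (κ i)) * K₀.map (fun a : ℂ => (MvPolynomial.C a : MvPolynomial σ ℂ))).det =
          (1 + Matrix.diagonal (fun i => MvPolynomial.X (κ i)) * K₁.map (fun a : ℂ => (MvPolynomial.C a : MvPolynomial σ ℂ))).det := by
  intro R σ K₀ κ hκ hz
  -- (1) principal minors `≤ (1/2)^{size}`
  have hmin : ∀ (k : ℕ) (w : Fin (k + 1) → Fin R), Function.Injective w →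
      ‖(K₀.submatrix w w).det‖ ≤ (1 / 2 : ℝ) ^ (k + 1) :=
    fun k w hw => norm_det_submatrix_le K₀ κ hκ hz k w hw
  -- (2) Theorem 4 (the cycle-mean bound) with `ν = 1/2`
  have hcyc := CycleBound.stub_cycleBound CycleBalancing.stub_cycleBalancing
    (ArcInduction.stub_arcInduction ArcStep.stub_arcStep PermCounts.stub_permCounts)
    R K₀ (1 / 2) (by norm_num) hmin
  set M : ℝ := 120 * (R : ℝ) ^ 3 with hM
  have hM0 : 0 ≤ M := by positivity
  have hcycM : ∀ (n : ℕ) (v : Fin (n + 1) → Fin R), Function.Injective v →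
      ‖∏ t : Fin (n + 1), K₀ (v t) (v (t + 1))‖ ≤ M ^ (n + 1) := by
    intro n v hv
    have h := hcyc n v hv
    have h240 : (240 * (R : ℝ) ^ 3 * (1 / 2)) = M := by rw [hM]; ring
    rwa [h240] at h
  -- (3) max-plus balancing at level `M` (vacuous for `R = 0`)
  obtain ⟨d, hd0, hd⟩ : ∃ d : Fin R → ℝ, (∀ i, 0 < d i) ∧ ∀ i j, d i * ‖K₀ i j‖ / d j ≤ M := by
    rcases Nat.eq_zero_or_pos R with rfl | hR
    · exact ⟨fun _ => 1, fun i => i.elim0, fun i => i.elim0⟩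
    · have hRpos : (0 : ℝ) < R := Nat.cast_pos.mpr hR
      exact CycleBalancing.stub_cycleBalancing R K₀ M (by rw [hM]; positivity) hcycM
  -- (4) the balanced matrix `D K₀ D⁻¹`
  set K₁ : Matrix (Fin R) (Fin R) ℂ :=
    Matrix.of fun i j => ((d i : ℝ) : ℂ) * K₀ i j * (((d j : ℝ) : ℂ))⁻¹ with hK₁
  have hentry : ∀ i j, ‖K₁ i j‖ ≤ M := by
    intro i j
    rw [hK₁, Matrix.of_apply, norm_mul, norm_mul, norm_inv, Complex.norm_real, Complex.norm_real,
      Real.norm_of_nonneg (hd0 i).le, Real.norm_of_nonneg (hd0 j).le]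
    have := hd i j
    rwa [div_eq_mul_inv] at this
  have hnorm : ‖Matrix.toEuclideanCLM (𝕜 := ℂ) K₁‖ ≤ (R : ℝ) ^ 2 * M :=
    norm_toEuclideanCLM_le_of_entry_le K₁ hM0 hentry
  have hdet₁ := det_pencil_diagConj K₀ κ (fun i => ((d i : ℝ) : ℂ))
    (fun i => Complex.ofReal_ne_zero.mpr (hd0 i).ne')
  refine ⟨K₁, hnorm.trans_eq (by rw [hM]; ring), ?_⟩
  rw [← hdet₁]

end Summit.ValiantsHypothesis.ValiantsHypothesis.Theorems.PriceOfContractivity.BalancedBudgetInjective
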